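import Summits.HodgeConjecture.HodgeConjecture.Theorems.Ring2BindersAbelianSchemeVHCPrimitiveMiddleFamily
import Summits.HodgeConjecture.HodgeConjecture.Theorems.Ring2BindersAbelianSchemeVHCCMGerm
import Summits.HodgeConjecture.HodgeConjecture.Theorems.PadicSemiregularLiftHodgeAbelianVarietiesCMPivotConverseHolds
import Literature.AlgebraicGeometry.HodgeTheory.HodgeClassesProductSpanCMSquare
import Literature.AlgebraicGeometry.Milne1999.CodesHCOfCMHodgeHypothesis
import Literature.NumberTheory.EllipticCurves.CMEndomorphismOfMulMemLattice
import HarnessLib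

/-!
# Ring 2 — binder seat b02 (Hodge ladder stage 3): the GERM engine — the shadow, the global first Lefschetz step and the
# CM padding `𝒳 ↦ 𝒳 × E₀` read at a filter of fibres, for row b08 `LocalVHCAtCM` (fact-free)

HONEST FRAMING: research route conditional on HC_CM; not a corollary; Q11.4-sentence-2 already refuted in dim ≥ 3.

Cell `pub-hodge-ring2`, binder seat `ring2-b02` (row b02 `Ring2.Hypotheses.AbelianSchemeVHC`, OPEN, do-not-mint). This part
serves row **b08** `Ring2.Hypotheses.LocalVHCAtCM` (`Theorems/Ring2HypothesesCMPivot.lean`: Grothendieck's variational Hodge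
conjecture as a GERM at a CM fibre of a smooth projective family with quasi-projective total space and base; OPEN; the one row of
the dictionary on which `HC_CM` is load-bearing — the CM pivot `HC_CM ∧ b07 ∧ b08 ⟹ HC_AV`). `HC_CM`
(`Theses.RankFourFaces.CMAbelianHodge`) does not occur below; nothing here is a case of the Hodge conjecture; no `sorry`, no
definition, no NEW Literature fact, no node; «10 · 0» untouched.

WHAT THIS PART DOES. Parts `…VHCShadow` (p246125), `…VHCPrimitiveStep` (p251133) and `…VHCPrimitiveMiddleFamily` (p253550)
reduce row b02, per quasi-projective abelian-fibred carrier, to its instances on fibrewise LEFSCHETZ-PRIMITIVE classes and then, by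
padding with elliptic curves, to primitive classes of the MIDDLE degree — with the conclusion read on a prescribed SET `T` of
fibres. Row b08 concludes on a NEIGHBOURHOOD of the CM point `s₀` that depends on the instance, so its reductions must be read at
the neighbourhood FILTER `𝓝 s₀`; and its carriers carry a CM fibre, which the padding must preserve. This file supplies exactly
that, nothing being re-derived (the global constructions `exists_lowerShadow`, `exists_primitive_add_lefschetzPowTo`,
`exists_primitiveOneStepLift` are consumed by name):

* §1 `eventually_map_fiberι_mem_algebraicClasses_of_lowerHalf` — at ANY filter `l` of fibres, the conclusion of the variational
  statement in every codimension follows from the conclusion in codimensions `2p ≤ n` (the lower shadow has the same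
  algebraicity locus, fibre by fibre).
* §2 `eventually_map_fiberι_mem_algebraicClasses_of_forall_mem_primitiveClasses` — at any filter `l`, the conclusion in every
  codimension follows from the instances on fibrewise `K`-PRIMITIVE classes of codimension `2 ≤ p ≤ n/2` (strong induction on
  `p`; two eventualities are intersected at the step `W = W₀ + L_K W'`).
* §3 the CM-pivot typing read on the fibres and back: `HodgeAlong` ⟺ "fibrewise rational `(p,p)`" once every fibre is an
  abelian variety (iso transport), the anchor `e₀ = i₀ ≫ ι_{s₀}` moved to THE fibre; and the CM PADDING: for a CM abelian variety
  `A₀ ≅ 𝒳_{s₀}` and an abelian variety `E` of CM type, `A₀ × E ≅ (𝒳 × E)_{s₀}` and `A₀ × E` is CM in the eigenvalue typing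
  `IsCM[·]` of the CM pivot (the tree's `Milne1999.IsOfCMType.prod` through the unconditional bridge
  `CMPivot.isCM_iff_exists_cmSubalgebra`, Mumford §22); a CM elliptic curve exists on the tree's carrier (`ℂ/ℤ[i]`,
  `CMEndomorphism.exists_cmCurve_sqrt_neg`, `isOfCMType_of_cmCurve`).

The binder-level statement — row b08 ⟺ its fibrewise-primitive middle-degree part modulo Catanese (c21) — is the sequel
`Ring2BindersLocalVHCAtCMPrimitiveMiddle.lean`. FACT-FREE here (closures are the three standard axioms).

References: [VoisinHodgeI2002] §6.2.3 Def. 6.24, Thm. 6.25, Cor. 6.26, Rem. 6.27, §7.1.2; [VoisinHodgeII2003] Lemma 4.17, Thm. 4.18;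
[KerrPearlstein2011] §3.1; [Lieberman1968] main theorem; [Kleiman1968AlgebraicCycles] §2, Thm. 2A11; [MumfordAV1970] §19 Thm. 3, §22;
[Milne1999] §2 p. 54; [SilvermanAEC2009] Thm. VI.4.1 (b); [CharlesSchnell2014Notes] Conj. 11.3.1, Prop. 11.3.11 (proof);
[Hartshorne1977] II.3, III Prop. 10.1.
-/

-- every declaration of this problem lives in `Summit.HodgeConjecture.HodgeConjecture.…` (summit = sub-problem);
-- namespace `…Ring2.Binders` = the binder seats of the cell's Hodge-ladder stage 3 (`BINDER-OWNERS.md`)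
set_option linter.dupNamespace false

noncomputable section

open CategoryTheory CategoryTheory.Limits AlgebraicGeometry Topology Filter MonoidalCategory CartesianMonoidalCategory
open Literature.AlgebraicGeometry Literature.AlgebraicGeometry.Motives
open Literature.AlgebraicGeometry.HodgeTheory
open Literature.AlgebraicGeometry.Milne1999 (IsOfCMType)
open Literature.NumberTheory.EllipticCurves (CMEndomorphism.exists_cmCurve_sqrt_neg)

namespace Summit.HodgeConjecture.HodgeConjecture.Ring2.Binders

open Summit.HodgeConjecture.HodgeConjecture.Theorems.HodgeAbelianVarieties.CMPivot (isCM_iff_exists_cmSubalgebra)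

variable {𝒳 S : SchemeOver ℂ}

/-! ## §1 At a filter of fibres: the lower half of the codimensions decides (fact-free) -/

/-- **On a quasi-projective abelian-fibred carrier, at ANY filter `l` of fibres, the conclusion of the variational Hodge statement in
EVERY codimension follows from the conclusion in codimensions `2p ≤ n`** (anchor `s₀`): above the middle pass to the lower shadow
(`exists_lowerShadow`), which is algebraic exactly where `W` is, fibre by fibre; beyond `p > n` there are no non-zero `(p,p)`-classes.
The set form (`l = 𝓟 T`) is the shadow part's `map_fiberι_mem_algebraicClasses_of_lowerHalf`; the germ rows use `l = 𝓝 s₀`.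
FACT-FREE. [cite: KerrPearlstein2011, §3.1] [cite: VoisinHodgeII2003, Thm. 4.18] [cite: Lieberman1968, main theorem] -/
theorem eventually_map_fiberι_mem_algebraicClasses_of_lowerHalf (f : 𝒳 ⟶ S) {n : ℕ} (hf : IsSmoothProjectiveFamily f n)
    (h𝒳 : IsQuasiProjectiveOver 𝒳) (hS : IsQuasiProjectiveOver S) [IrreducibleSpace S.left]
    (hSs : AlgebraicGeometry.Smooth S.hom)
    (hA : ∀ s : ComplexPoints S, ∃ A' : AbelianVariety ℂ, A'.dim = n ∧ Nonempty (A'.X ≅ fiberOver f s))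
    (l : Filter (ComplexPoints S)) {s₀ : ComplexPoints S}
    (hlow : ∀ q : ℕ, 2 * q ≤ n → ∀ W' : complexBetti 𝒳 (2 * q),
      (∀ s : ComplexPoints S, IsRationalClass (complexBetti.map (fiberι f s) (2 * q) W') ∧
        IsOfHodgeType n (fiberOver f s) (2 * q) q q (complexBetti.map (fiberι f s) (2 * q) W')) →
      complexBetti.map (fiberι f s₀) (2 * q) W' ∈ algebraicClasses (fiberOver f s₀) q →
      ∀ᶠ s in l, complexBetti.map (fiberι f s) (2 * q) W' ∈ algebraicClasses (fiberOver f s) q)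
    (p : ℕ) (W : complexBetti 𝒳 (2 * p))
    (hW : ∀ s : ComplexPoints S, IsRationalClass (complexBetti.map (fiberι f s) (2 * p) W) ∧
      IsOfHodgeType n (fiberOver f s) (2 * p) p p (complexBetti.map (fiberι f s) (2 * p) W))
    (h₀ : complexBetti.map (fiberι f s₀) (2 * p) W ∈ algebraicClasses (fiberOver f s₀) p) :
    ∀ᶠ s in l, complexBetti.map (fiberι f s) (2 * p) W ∈ algebraicClasses (fiberOver f s) p := by
  by_cases hpn : 2 * p ≤ n
  · exact hlow p hpn W hW h₀
  by_cases hnp : n < p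
  · exact Filter.Eventually.of_forall fun s ↦ by
      rw [(hW s).2.eq_zero_pp_of_lt hnp]
      exact Submodule.zero_mem _
  obtain ⟨q, j, hqj, hp⟩ : ∃ q j : ℕ, 2 * q + j = n ∧ q + j = p := ⟨n - p, 2 * p - n, by omega, by omega⟩
  subst hp
  obtain ⟨W', hW', hiff⟩ := exists_lowerShadow f hf h𝒳 hS hSs hA hqj W hW
  exact (hlow q (by omega) W' hW' ((hiff s₀).2 h₀)).mono fun s hs ↦ (hiff s).1 hs

/-! ## §2 At a filter of fibres: the fibrewise-primitive instances of codimension `2 ≤ p ≤ n/2` decide (fact-free) -/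

/-- **On a quasi-projective abelian-fibred carrier with a global class `K` polarising every fibre, at ANY filter `l` of fibres, the
conclusion of the variational Hodge statement in EVERY codimension follows from its instances on fibrewise `K`-PRIMITIVE classes of
codimension `2 ≤ p ≤ n/2`** (anchor `s₀`). Inside the lower half, strong induction on `p`: `p = 0` (`algebraicClasses_zero`), `p = 1`
(Lefschetz `(1,1)` on the fibre), `p = l + 2`: `W = W₀ + L_K W'` GLOBALLY (`exists_primitive_add_lefschetzPowTo`), `W₀|` algebraic
eventually by the primitive instance, `W'|` eventually by induction — two eventualities along `l`, intersected —, `K| ∪ W'|` by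
`HardLefschetzNFold.L_mem_algebraicClasses_of_mem`; above the middle §1. The set form (`l = 𝓟 T`) is the step part's
`map_fiberι_mem_algebraicClasses_of_forall_mem_primitiveClasses`. FACT-FREE. [cite: VoisinHodgeI2002, Thm. 6.25, Cor. 6.26, Rem. 6.27
and §7.1.2] [cite: VoisinHodgeII2003, Thm. 4.18] [cite: KerrPearlstein2011, §3.1] [cite: Lieberman1968, main theorem] -/
theorem eventually_map_fiberι_mem_algebraicClasses_of_forall_mem_primitiveClasses (f : 𝒳 ⟶ S) {n : ℕ}
    (hf : IsSmoothProjectiveFamily f n) (h𝒳 : IsQuasiProjectiveOver 𝒳) (hS : IsQuasiProjectiveOver S)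
    [IrreducibleSpace S.left] (hSs : AlgebraicGeometry.Smooth S.hom)
    (hA : ∀ s : ComplexPoints S, ∃ A' : AbelianVariety ℂ, A'.dim = n ∧ Nonempty (A'.X ≅ fiberOver f s))
    (K : complexBetti 𝒳 2)
    (hK : ∀ s : ComplexPoints S, IsPolarizationClass n (fiberOver f s) (complexBetti.map (fiberι f s) 2 K))
    (l : Filter (ComplexPoints S)) {s₀ : ComplexPoints S}
    (hprim : ∀ p : ℕ, 2 ≤ p → 2 * p ≤ n → ∀ W : complexBetti 𝒳 (2 * p),
      (∀ s : ComplexPoints S, IsRationalClass (complexBetti.map (fiberι f s) (2 * p) W) ∧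
        IsOfHodgeType n (fiberOver f s) (2 * p) p p (complexBetti.map (fiberι f s) (2 * p) W)) →
      (∀ s : ComplexPoints S, complexBetti.map (fiberι f s) (2 * p) W ∈
        primitiveClasses (complexBetti.map (fiberι f s) 2 K) n (2 * p)) →
      complexBetti.map (fiberι f s₀) (2 * p) W ∈ algebraicClasses (fiberOver f s₀) p →
      ∀ᶠ s in l, complexBetti.map (fiberι f s) (2 * p) W ∈ algebraicClasses (fiberOver f s) p)
    (p : ℕ) (W : complexBetti 𝒳 (2 * p))
    (hW : ∀ s : ComplexPoints S, IsRationalClass (complexBetti.map (fiberι f s) (2 * p) W) ∧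
      IsOfHodgeType n (fiberOver f s) (2 * p) p p (complexBetti.map (fiberι f s) (2 * p) W))
    (h₀ : complexBetti.map (fiberι f s₀) (2 * p) W ∈ algebraicClasses (fiberOver f s₀) p) :
    ∀ᶠ s in l, complexBetti.map (fiberι f s) (2 * p) W ∈ algebraicClasses (fiberOver f s) p := by
  choose Λ hΛ using fun s ↦ (hK s).exists_hardLefschetzNFold (hf.isSmoothProjective s)
  -- the lower half, by strong induction on the codimension
  have hlow : ∀ q : ℕ, 2 * q ≤ n → ∀ W' : complexBetti 𝒳 (2 * q),
      (∀ s : ComplexPoints S, IsRationalClass (complexBetti.map (fiberι f s) (2 * q) W') ∧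
        IsOfHodgeType n (fiberOver f s) (2 * q) q q (complexBetti.map (fiberι f s) (2 * q) W')) →
      complexBetti.map (fiberι f s₀) (2 * q) W' ∈ algebraicClasses (fiberOver f s₀) q →
      ∀ᶠ s in l, complexBetti.map (fiberι f s) (2 * q) W' ∈ algebraicClasses (fiberOver f s) q := by
    intro q
    induction q using Nat.strong_induction_on with
    | _ q ih =>
    intro hqn W' hW' h₀'
    rcases q with _ | _ | k
    · -- `q = 0`
      exact Filter.Eventually.of_forall fun s ↦ by
        rw [algebraicClasses_zero]
        exact Submodule.mem_top
    · -- `q = 1`: Lefschetz `(1,1)` on every fibre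
      exact Filter.Eventually.of_forall fun s ↦
        lefschetzOneOne_rational_holds (hf.isSmoothProjective s) _ (hW' s).1 (hW' s).2
    · -- `q = k + 2`: the first Lefschetz step, globally
      obtain ⟨W₀, W₁, hdec, hW₀, hP₀, hW₁, halg⟩ :=
        exists_primitive_add_lefschetzPowTo f hf h𝒳 hS hSs hA K hK hqn W' hW'
      obtain ⟨h₀₀, h₀₁⟩ := halg s₀ h₀'
      have h₁ : ∀ᶠ s in l, complexBetti.map (fiberι f s) (2 * (k + 1)) W₁ ∈ algebraicClasses (fiberOver f s) (k + 1) :=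
        ih (k + 1) (by omega) (by omega) W₁ hW₁ h₀₁
      have h₂ : ∀ᶠ s in l,
          complexBetti.map (fiberι f s) (2 * (k + 1 + 1)) W₀ ∈ algebraicClasses (fiberOver f s) (k + 1 + 1) :=
        hprim (k + 1 + 1) (by omega) hqn W₀ hW₀ hP₀ h₀₀
      filter_upwards [h₁, h₂] with s h₁ h₂
      rw [hdec, map_add, map_lefschetzPowTo]
      refine Submodule.add_mem _ h₂ ?_
      rw [← hΛ s]
      exact (Λ s).L_mem_algebraicClasses_of_mem 1 (k + 1) _ h₁
  exact eventually_map_fiberι_mem_algebraicClasses_of_lowerHalf f hf h𝒳 hS hSs hA l hlow p W hW h₀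

/-! ## §3 The CM-pivot typing read on the fibres; the CM padding `𝒳 ↦ 𝒳 × E` -/

/-- `IsCM[A]` — CM type in the eigenvalue typing of the CM pivot (verbatim `Theorems/Ring2HypothesesCMPivot.lean`): an
endomorphism with `2 · dim A` distinct eigenvalues on `H¹(A(ℂ); ℂ)`. Local notation only. -/
local notation3 (prettyPrint := false) "IsCM[" A "]" =>
  ∃ (ψ : A ⟶ A) (μ : Fin (2 * AbelianVariety.dim A) → ℂ), Function.Injective μ ∧
    ∀ i, Module.End.HasEigenvalue (HodgeTheory.complexBetti.map ψ.hom.hom.hom 1).hom (μ i)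

/-- **`HodgeAlong` read on the fibres.** Along a smooth projective family of relative dimension `m` all of whose complex fibres are
abelian varieties, a global class which is rational `(p,p)` on every abelian PRESENTATION `eB = i ≫ ι_u : B.X ⟶ 𝒳` of a fibre is
rational `(p,p)` on every fibre `𝒳_s` (iso transport `isRationalClass_map_iff_of_iso`, `isOfHodgeType_map_iff_of_iso`,
`dim B = m`). [cite: CharlesSchnell2014Notes, Conj. 11.3.1] -/
theorem forall_isRationalClass_and_isOfHodgeType_of_hodgeAlong {m : ℕ} (f : 𝒳 ⟶ S) (hf : IsSmoothProjectiveFamily f m)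
    (hab : ∀ t : ComplexPoints S, ∃ B : AbelianVariety ℂ, Nonempty (B.X ≅ fiberOver f t))
    {p : ℕ} (G : complexBetti 𝒳 (2 * p))
    (hG : ∀ (B : AbelianVariety ℂ) (eB : B.X ⟶ 𝒳) (u : ComplexPoints S),
      (∃ i : B.X ≅ fiberOver f u, eB = i.hom ≫ fiberι f u) →
        IsRationalClass (complexBetti.map eB (2 * p) G) ∧
          IsOfHodgeType B.dim B.X (2 * p) p p (complexBetti.map eB (2 * p) G))
    (s : ComplexPoints S) :
    IsRationalClass (complexBetti.map (fiberι f s) (2 * p) G) ∧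
      IsOfHodgeType m (fiberOver f s) (2 * p) p p (complexBetti.map (fiberι f s) (2 * p) G) := by
  obtain ⟨B, ⟨i⟩⟩ := hab s
  have h := hG B (i.hom ≫ fiberι f s) s ⟨i, rfl⟩
  rw [complexBetti.map_comp_apply'] at h
  have hdim : B.dim = m := dim_eq_of_iso_fiberOver hf i
  refine ⟨(isRationalClass_map_iff_of_iso i).1 h.1, ?_⟩
  rw [← hdim]
  exact (isOfHodgeType_map_iff_of_iso i).1 h.2

/-- **… and back**: a global class rational `(p,p)` on every fibre `𝒳_s` of a smooth projective family of relative dimension `m` is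
rational `(p,p)` on every abelian presentation `eB = i ≫ ι_u` of a fibre (`dim B = m` by `dim_eq_of_iso_fiberOver`).
[cite: CharlesSchnell2014Notes, Conj. 11.3.1] -/
theorem hodgeAlong_of_forall_isRationalClass_and_isOfHodgeType {m : ℕ} (f : 𝒳 ⟶ S) (hf : IsSmoothProjectiveFamily f m)
    {p : ℕ} (G : complexBetti 𝒳 (2 * p))
    (hW : ∀ s : ComplexPoints S, IsRationalClass (complexBetti.map (fiberι f s) (2 * p) G) ∧
      IsOfHodgeType m (fiberOver f s) (2 * p) p p (complexBetti.map (fiberι f s) (2 * p) G))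
    (B : AbelianVariety ℂ) (eB : B.X ⟶ 𝒳) (u : ComplexPoints S)
    (heB : ∃ i : B.X ≅ fiberOver f u, eB = i.hom ≫ fiberι f u) :
    IsRationalClass (complexBetti.map eB (2 * p) G) ∧
      IsOfHodgeType B.dim B.X (2 * p) p p (complexBetti.map eB (2 * p) G) := by
  obtain ⟨i, rfl⟩ := heB
  rw [complexBetti.map_comp_apply', dim_eq_of_iso_fiberOver hf i]
  exact ⟨(isRationalClass_map_iff_of_iso i).2 (hW u).1, (isOfHodgeType_map_iff_of_iso i).2 (hW u).2⟩

/-- **The anchor on a presentation is the anchor on THE fibre**: for `i : A.X ≅ 𝒳_s`, `(i ≫ ι_s)^* G` is algebraic on `A.X` iff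
`G|_{𝒳_s}` is algebraic on `𝒳_s` (`mem_algebraicClasses_map_iff_of_iso`). [cite: Fulton1998, Example 19.1.4] -/
theorem map_comp_fiberι_mem_algebraicClasses_iff (f : 𝒳 ⟶ S) {s : ComplexPoints S} {A : AbelianVariety ℂ}
    (i : A.X ≅ fiberOver f s) {p : ℕ} (G : complexBetti 𝒳 (2 * p)) :
    complexBetti.map (i.hom ≫ fiberι f s) (2 * p) G ∈ algebraicClasses A.X p ↔
      complexBetti.map (fiberι f s) (2 * p) G ∈ algebraicClasses (fiberOver f s) p := by
  rw [complexBetti.map_comp_apply']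
  exact mem_algebraicClasses_map_iff_of_iso i

/-- **The padded fibre at the CM point**: for `i₀ : A₀.X ≅ 𝒳_{s₀}` and any abelian variety `E`, the product abelian variety
`A₀ × E` (`AbelianVariety.prod`) presents the fibre of `pr_𝒳 ≫ f : 𝒳 × E ⟶ S` over `s₀` (`i₀ ▷ E` followed by
`𝒳_{s₀} × E ≅ (𝒳 × E)_{s₀}`, `exists_fiberOver_fst_comp_iso`). [cite: Hartshorne1977, II.3 (p. 89) and III Prop. 10.1 (b)]
[cite: MumfordAV1970, §1 (products of abelian varieties)] -/
theorem nonempty_prod_iso_fiberOver_fst_comp (f : 𝒳 ⟶ S) {s₀ : ComplexPoints S} {A₀ : AbelianVariety ℂ}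
    (i₀ : A₀.X ≅ fiberOver f s₀) (E : AbelianVariety ℂ) :
    Nonempty ((A₀.prod E).X ≅ fiberOver (fst 𝒳 E.X ≫ f) s₀) := by
  obtain ⟨e, -⟩ := exists_fiberOver_fst_comp_iso f E.X s₀
  exact ⟨whiskerRightIso i₀ E.X ≪≫ e⟩

/-- **A product of a CM abelian variety with an abelian variety of CM type is CM, in the eigenvalue typing of the CM pivot**:
`IsCM[A₀]` ⟺ `End⁰(A₀)` contains a commutative reduced subalgebra of rank `2 dim A₀` (the tree's unconditional bridge
`CMPivot.isCM_iff_exists_cmSubalgebra`, Mumford §22), products of CM-type abelian varieties are of CM type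
(`Milne1999.IsOfCMType.prod`, `S × 0 + 0 × T ⊆ End⁰(A₀ × E)`), and back. [cite: MumfordAV1970, §19 Thm. 3 and §22]
[cite: Milne1999, §2 p. 54] -/
theorem isCM_prod_of_isCM_of_isOfCMType {A₀ E : AbelianVariety ℂ} (h₀ : IsCM[A₀]) (hE : IsOfCMType E) :
    IsCM[A₀.prod E] := by
  have h₀' : IsOfCMType A₀ := (isCM_iff_exists_cmSubalgebra A₀).1 h₀
  exact (isCM_iff_exists_cmSubalgebra (A₀.prod E)).2 (h₀'.prod hE)

/-- **A CM elliptic curve on the tree's carrier**: an abelian variety `E₀` of dimension `1` of CM type (`ℂ/ℤ[i]` with `[i]`,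
`[i]² = -1`: `CMEndomorphism.exists_cmCurve_sqrt_neg`; of CM type by `isOfCMType_of_cmCurve`, `ℚ([i]) ⊆ End⁰(E₀)` of rank `2`).
[cite: SilvermanAEC2009, Thm. VI.4.1 (b)] [cite: Milne1999, §2 p. 54] -/
theorem exists_dim_eq_one_isOfCMType : ∃ E₀ : AbelianVariety ℂ, E₀.dim = 1 ∧ IsOfCMType E₀ := by
  obtain ⟨E₀, ψ₀, hE₀, hψ₀⟩ := CMEndomorphism.exists_cmCurve_sqrt_neg 1 one_pos
  exact ⟨E₀, hE₀, isOfCMType_of_cmCurve hE₀ one_pos hψ₀⟩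

/-! ## Audit: fact-free (closures are the three standard axioms; no named fact, no `HC_CM`) -/

#print axioms Summit.HodgeConjecture.HodgeConjecture.Ring2.Binders.eventually_map_fiberι_mem_algebraicClasses_of_lowerHalf
#print axioms Summit.HodgeConjecture.HodgeConjecture.Ring2.Binders.eventually_map_fiberι_mem_algebraicClasses_of_forall_mem_primitiveClasses
#print axioms Summit.HodgeConjecture.HodgeConjecture.Ring2.Binders.isCM_prod_of_isCM_of_isOfCMType
#print axioms Summit.HodgeConjecture.HodgeConjecture.Ring2.Binders.exists_dim_eq_one_isOfCMType

end Summit.HodgeConjecture.HodgeConjecture.Ring2.Binders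

end
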